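import Summits.AtomisticToContinuum.Crystallization.Theorems.ChargedEnergyGap.Negative.PeriodicMinimisers

/-!
# Crux `LocalToGlobal` (stmt-AtomisticToContinuum-14232), line `phase-gap-rate-upgrade`: vocabulary of the
# charge-density split and its glue

The crux `LocalToGlobal : TruncatedCensusGap → ChargedEnergyGap` of route `PricedLinkCensus` is folded into the
sibling crux `ChargedEnergyGap` (stmt-AtomisticToContinuum-14231) by `localToGlobal_of_chargedEnergyGap`
(`Theorems/PricedLinkCensusLocalToGlobalFold.lean`): the antecedent is inert (crux workfile
`Cruxes/LocalToGlobal/STRATEGY-CENSUS.md` §1).  The line `phase-gap-rate-upgrade`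
(`Cruxes/LocalToGlobal/Lines/phase_gap_rate_upgrade.lean`) cuts the consequent by CHARGE DENSITY of the
Lennard-Jones configuration itself.  This file fixes the vocabulary of that cut as route-posited objects and proves
the bookkeeping between them (everything `[folklore]`; `e* = eStar`, `#ch = charged (1/100)` from
`Theorems/ChargedEnergyGap/Negative/*`):

* `PhaseGapWith η ρ g` — the parametrised inequality: every finite injective configuration with at least `ρ·N` sites
  not charge-free at tolerance `η` has `N·(e* + g) ≤ E_LJ`;
* `QualitativeChargeGapWith η` (at `η = 1/100`: Sub₁, the PHASE GAP) — `∀ ρ > 0, ∃ g > 0, PhaseGapWith η ρ g`, written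
  out so that at `η = 1/100` it is the registered stub `stub_qualitativeChargeGap` of the line VERBATIM (`Iff.rfl`:
  `qualitativeChargeGapWith_iff`);
* `SparsePricingWith η` (at `1/100`: the honest open core of Sub₂) — a uniform price per charged site for SPARSE charge
  in NEAR-MINIMISERS: `∃ ρ₁ κ C, 0 < ρ₁ ∧ 0 < κ ∧` every injective `y` with `#ch ≤ ρ₁ N` and `E_LJ(y) ≤ N (e* + ρ₁)`
  has `N e* + κ #ch − C N^{2/3} ≤ E_LJ(y)`;
* `PeriodicPhaseGapWith η` — the periodic twin of Sub₁: `∀ ρ > 0, ∃ g > 0`, every periodic configuration whose motif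
  has charged fraction `≥ ρ` has `e* + g ≤ e(Q)`;
* `QualitativeChargeGapEventuallyWith η` — Sub₁ asserted only for `N ≥ N₀(ρ)`.
All four are PREDICATES of the tolerance (route-posited objects of this line, like `GapWith` / `NoBoundary` /
`PeriodicPricing` of the sibling crux), not literature facts.

Glue proved here: `localToGlobal_of_subs` (Sub₁ → (Sub₁ → CEG) → LocalToGlobal: the composition of the line over
the named statements), `qualitativeChargeGap_of_chargedEnergyGap` (Sub₁ is a weakening of 14231, `g = κρ`),
`sparsePricing_of_chargedEnergyGap`, **`chargedEnergyGap_of_qualitativeChargeGap_of_sparsePricing`** (the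
bookkeeping `Sub₁ → SparsePricing → ChargedEnergyGap` with `κ' = min κ (min g(ρ₁) ρ₁)`, `C' = max C 0`), hence
`chargedEnergyGap_iff_qualitativeChargeGap_and_sparsePricing` and `qualitativeToPricedGap_iff_sparsePricing`
(the line's stub 2 `Sub₁ → ChargedEnergyGap` is EQUIVALENT to `Sub₁ → SparsePricing`), and
`qualitativeChargeGap_of_periodicPhaseGap` (provers of Sub₁ may work on periodic configurations only: far
periodisation `periodiseFar`, charge of motif points read in the point set = charge in `y`).

Not here (separate files of the same line): `ZeroChargeBulk` from Sub₁ alone; Sub₁ from its eventual form; the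
converse periodic form.
-/

noncomputable section

namespace Summit.AtomisticToContinuum.Crystallization.Theorems.PricedLinkCensusLocalToGlobalPhaseGap

open Literature.MathematicalPhysics.StatisticalMechanics
open Literature.Geometry.DiscreteGeometry
open Summit.AtomisticToContinuum.Crystallization.Theses.PricedLinkCensus
open Summit.AtomisticToContinuum.Crystallization.Theorems.ChargedEnergyGapNegative
open scoped BigOperators

/-! ## The vocabulary -/

/-- **The phase-gap inequality with parameters**: tolerance `η`, charged fraction `ρ`, volume gap `g` — every finite
injective configuration of `ℝ³` with at least `ρ·N` sites that are not charge-free at tolerance `η` has Lennard-Jones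
energy at least `N·(e* + g)`. [folklore] -/
def PhaseGapWith (η ρ g : ℝ) : Prop :=
  ∀ (N : ℕ) (y : Fin N → E3), Function.Injective y → ρ * (N : ℝ) ≤ (charged η y : ℝ) →
    (N : ℝ) * (eStar + g) ≤ interactionEnergy lennardJones y

/-- **The QUALITATIVE PHASE GAP at tolerance `η`** (`QualitativeChargeGapWith η`; at `η = 1/100` this is Sub₁ of the
line, the registered stub `stub_qualitativeChargeGap`, verbatim): for every `ρ > 0` there is `g > 0` such that every
finite injective configuration of `ℝ³` with at least `ρ·N` sites not charge-free at tolerance `η` has Lennard-Jones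
energy `≥ N·(e* + g)`, `e* = ⨅` over periodic configurations of the energy per particle.  No rate in `ρ`, no
boundary term. [folklore] -/
def QualitativeChargeGapWith (η : ℝ) : Prop :=
  ∀ ρ : ℝ, 0 < ρ → ∃ g : ℝ, 0 < g ∧ ∀ (N : ℕ) (y : Fin N → EuclideanSpace ℝ (Fin 3)),
    Function.Injective y →
      ρ * (N : ℝ) ≤ (Nat.card {i : Fin N // ¬ Literature.Geometry.DiscreteGeometry.IsChargeFree η y i} : ℝ) →
        (N : ℝ) * ((⨅ Q : Literature.MathematicalPhysics.StatisticalMechanics.PeriodicConfiguration 3,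
            Q.energyPerParticle Literature.MathematicalPhysics.StatisticalMechanics.lennardJones) + g) ≤
          Literature.MathematicalPhysics.StatisticalMechanics.interactionEnergy
            Literature.MathematicalPhysics.StatisticalMechanics.lennardJones y

/-- **SPARSE PRICING in near-minimisers at tolerance `η`** (`SparsePricingWith η`; at `1/100` the open core of Sub₂):
there are `ρ₁ > 0`, `κ > 0` and `C` such that every finite injective configuration with FEW charged sites
(`#ch ≤ ρ₁·N`) and LOW energy (`E_LJ ≤ N·(e* + ρ₁)`) satisfies the priced gap `N·e* + κ·#ch − C·N^{2/3} ≤ E_LJ`.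
The priced gap restricted to sparse near-minimisers; together with the phase gap it is equivalent to
`ChargedEnergyGap` (`chargedEnergyGap_iff_qualitativeChargeGap_and_sparsePricing`). [folklore] -/
def SparsePricingWith (η : ℝ) : Prop :=
  ∃ ρ₁ κ C : ℝ, 0 < ρ₁ ∧ 0 < κ ∧ ∀ (N : ℕ) (y : Fin N → EuclideanSpace ℝ (Fin 3)),
    Function.Injective y →
      (Nat.card {i : Fin N // ¬ Literature.Geometry.DiscreteGeometry.IsChargeFree η y i} : ℝ) ≤
          ρ₁ * (N : ℝ) →
        Literature.MathematicalPhysics.StatisticalMechanics.interactionEnergy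
            Literature.MathematicalPhysics.StatisticalMechanics.lennardJones y ≤
          (N : ℝ) * ((⨅ Q : Literature.MathematicalPhysics.StatisticalMechanics.PeriodicConfiguration 3,
            Q.energyPerParticle Literature.MathematicalPhysics.StatisticalMechanics.lennardJones) + ρ₁) →
        (N : ℝ) * (⨅ Q : Literature.MathematicalPhysics.StatisticalMechanics.PeriodicConfiguration 3,
            Q.energyPerParticle Literature.MathematicalPhysics.StatisticalMechanics.lennardJones) +
            κ * (Nat.card {i : Fin N // ¬ Literature.Geometry.DiscreteGeometry.IsChargeFree η y i} : ℝ) -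
            C * (N : ℝ) ^ (2 / 3 : ℝ) ≤
          Literature.MathematicalPhysics.StatisticalMechanics.interactionEnergy
            Literature.MathematicalPhysics.StatisticalMechanics.lennardJones y

/-- **The PERIODIC PHASE GAP at tolerance `η`** (`PeriodicPhaseGapWith η`, periodic twin of Sub₁): for every `ρ > 0`
there is `g > 0` such that every periodic configuration of `ℝ³` whose motif has charged fraction at least `ρ` (charge
read in the infinite point set, tolerance `η`) has energy per particle `≥ e* + g`. [folklore] -/
def PeriodicPhaseGapWith (η : ℝ) : Prop :=
  ∀ ρ : ℝ, 0 < ρ → ∃ g : ℝ, 0 < g ∧ ∀ Q : PeriodicConfiguration 3,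
    ρ ≤ chargedFraction η Q → eStar + g ≤ Q.energyPerParticle lennardJones

/-- **The phase gap for large `N` only** (`QualitativeChargeGapEventuallyWith η`): for every `ρ > 0` there are `g > 0`
and `N₀` such that the phase-gap inequality at tolerance `η` holds for all configurations of at least `N₀` points.
[folklore] -/
def QualitativeChargeGapEventuallyWith (η : ℝ) : Prop :=
  ∀ ρ : ℝ, 0 < ρ → ∃ g : ℝ, 0 < g ∧ ∃ N₀ : ℕ, ∀ (N : ℕ) (y : Fin N → E3), N₀ ≤ N →
    Function.Injective y → ρ * (N : ℝ) ≤ (charged η y : ℝ) →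
      (N : ℝ) * (eStar + g) ≤ interactionEnergy lennardJones y

/-! ## Reading the definitions back -/

/-- `QualitativeChargeGapWith η ↔ ∀ ρ > 0, ∃ g > 0, PhaseGapWith η ρ g`, by `Iff.rfl`. [folklore] -/
theorem qualitativeChargeGapWith_iff (η : ℝ) :
    QualitativeChargeGapWith η ↔ ∀ ρ : ℝ, 0 < ρ → ∃ g : ℝ, 0 < g ∧ PhaseGapWith η ρ g :=
  Iff.rfl

/-- At `η = 1/100`, `QualitativeChargeGapWith` IS the registered stub `stub_qualitativeChargeGap` of line
`phase-gap-rate-upgrade` (crux stmt-AtomisticToContinuum-14232), by `Iff.rfl`. [folklore] -/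
theorem qualitativeChargeGapWith_iff_stub :
    QualitativeChargeGapWith (1 / 100) ↔
      ∀ ρ : ℝ, 0 < ρ → ∃ g : ℝ, 0 < g ∧ ∀ (N : ℕ) (y : Fin N → EuclideanSpace ℝ (Fin 3)),
        Function.Injective y →
          ρ * (N : ℝ) ≤ (Nat.card {i : Fin N // ¬ Literature.Geometry.DiscreteGeometry.IsChargeFree
              (1 / 100 : ℝ) y i} : ℝ) →
            (N : ℝ) * ((⨅ Q : Literature.MathematicalPhysics.StatisticalMechanics.PeriodicConfiguration 3,
                Q.energyPerParticle Literature.MathematicalPhysics.StatisticalMechanics.lennardJones) + g) ≤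
              Literature.MathematicalPhysics.StatisticalMechanics.interactionEnergy
                Literature.MathematicalPhysics.StatisticalMechanics.lennardJones y :=
  Iff.rfl

/-- `SparsePricingWith` read back over `eStar` / `charged`. [folklore] -/
theorem sparsePricingWith_iff (η : ℝ) :
    SparsePricingWith η ↔ ∃ ρ₁ κ C : ℝ, 0 < ρ₁ ∧ 0 < κ ∧ ∀ (N : ℕ) (y : Fin N → E3), Function.Injective y →
      (charged η y : ℝ) ≤ ρ₁ * (N : ℝ) →
        interactionEnergy lennardJones y ≤ (N : ℝ) * (eStar + ρ₁) →
          (N : ℝ) * eStar + κ * (charged η y : ℝ) - C * (N : ℝ) ^ (2 / 3 : ℝ) ≤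
            interactionEnergy lennardJones y :=
  Iff.rfl

/-- `#charged ≤ N`. [folklore] -/
theorem charged_le (η : ℝ) {N : ℕ} (y : Fin N → E3) : (charged η y : ℝ) ≤ N := by
  unfold charged
  exact_mod_cast (Finite.card_subtype_le _).trans_eq (Nat.card_fin N)

/-- `PhaseGapWith` is antitone in the gap `g`. [folklore] -/
theorem PhaseGapWith.mono {η ρ g g' : ℝ} (h : PhaseGapWith η ρ g) (hg : g' ≤ g) : PhaseGapWith η ρ g' := by
  intro N y hy hρ
  have := h N y hy hρ
  have hN : (0 : ℝ) ≤ N := Nat.cast_nonneg N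
  nlinarith

/-- `PhaseGapWith` is monotone in the charged fraction `ρ`. [folklore] -/
theorem PhaseGapWith.of_le {η ρ ρ' g : ℝ} (h : PhaseGapWith η ρ g) (hρ : ρ ≤ ρ') : PhaseGapWith η ρ' g := by
  intro N y hy hρ'
  have hN : (0 : ℝ) ≤ N := Nat.cast_nonneg N
  exact h N y hy (le_trans (by nlinarith) hρ')

/-! ## The composition of the line over the named statements -/

/-- **The line's composition** (registered on the crux item as the statement this file proves): Sub₁ and Sub₂
(`Sub₁ → ChargedEnergyGap`) prove the crux `LocalToGlobal` — modus ponens and the fold (the antecedent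
`TruncatedCensusGap` is discarded). [folklore] -/
theorem localToGlobal_of_subs : QualitativeChargeGapWith (1 / 100) → (QualitativeChargeGapWith (1 / 100) → ChargedEnergyGap) → LocalToGlobal :=
  fun h₁ h₂ _ => h₂ h₁

/-! ## Sub₁ is a weakening of the sibling crux -/

/-- An allowance-free price `κ ≥ 0` gives the phase gap with `g = κ·ρ` (`ρ ≥ 0`). [folklore] -/
theorem phaseGapWith_of_noBoundary {η κ ρ : ℝ} (h : NoBoundary η κ) (hρ : 0 ≤ ρ) :
    PhaseGapWith η ρ (κ * ρ) := by
  intro N y hy hρN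
  have h1 := h N y hy
  have hN : (0 : ℝ) ≤ N := Nat.cast_nonneg N
  rcases le_or_gt 0 κ with hκ | hκ
  · have : κ * (ρ * N) ≤ κ * (charged η y : ℝ) := mul_le_mul_of_nonneg_left hρN hκ
    nlinarith
  · -- a negative price: `N e* ≤ E` already gives the (negative) gap
    have h0 := card_mul_eStar_le (N := N) hy
    have : κ * ρ ≤ 0 := mul_nonpos_of_nonpos_of_nonneg hκ.le hρ
    nlinarith

/-- **`ChargedEnergyGap → QualitativeChargeGap`** (Sub₁ is a genuine weakening of stmt-AtomisticToContinuum-14231):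
by the no-boundary reduction the sibling crux gives an allowance-free price `κ > 0`, and then `g = κρ`. [folklore] -/
theorem qualitativeChargeGap_of_chargedEnergyGap (h : ChargedEnergyGap) : QualitativeChargeGapWith (1 / 100) := by
  rw [qualitativeChargeGapWith_iff]
  obtain ⟨κ, hκ, hNB⟩ := chargedEnergyGap_iff_noBoundary.1 h
  intro ρ hρ
  exact ⟨κ * ρ, mul_pos hκ hρ, phaseGapWith_of_noBoundary hNB hρ.le⟩

/-- **`ChargedEnergyGap → SparsePricingWith (1/100)`** (restriction to the sparse near-minimisers, `ρ₁ = 1`).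
[folklore] -/
theorem sparsePricing_of_chargedEnergyGap (h : ChargedEnergyGap) : SparsePricingWith (1 / 100) := by
  obtain ⟨κ, C, hκ, hG⟩ := chargedEnergyGap_iff.1 h
  exact ⟨1, κ, C, one_pos, hκ, fun N y hy _ _ => hG N y hy⟩

/-! ## The bookkeeping: Sub₁ and sparse pricing give the priced gap -/

/-- **BOOKKEEPING** (`Sub₁ → SparsePricing → ChargedEnergyGap`).  Given the phase gap `g = g(ρ₁)` at the sparse
threshold `ρ₁` and the sparse price `κ` with allowance `C`, the priced gap holds with `κ' = min κ (min g ρ₁)` and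
`C' = max C 0`: a configuration with `#ch ≥ ρ₁N` pays `gN ≥ g·#ch` (Sub₁); one with `#ch < ρ₁N` and
`E > N(e* + ρ₁)` pays `ρ₁N > ρ₁·#ch`; the remaining sparse near-minimisers pay `κ` per charged site by hypothesis.
[folklore] -/
theorem chargedEnergyGap_of_qualitativeChargeGap_of_sparsePricing (h₁ : QualitativeChargeGapWith (1 / 100))
    (h₂ : SparsePricingWith (1 / 100)) : ChargedEnergyGap := by
  rw [qualitativeChargeGapWith_iff] at h₁
  rw [sparsePricingWith_iff] at h₂
  obtain ⟨ρ₁, κ, C, hρ₁, hκ, hS⟩ := h₂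
  obtain ⟨g, hg, hP⟩ := h₁ ρ₁ hρ₁
  rw [chargedEnergyGap_iff]
  refine ⟨min κ (min g ρ₁), max C 0, lt_min hκ (lt_min hg hρ₁), fun N y hy => ?_⟩
  have hN : (0 : ℝ) ≤ N := Nat.cast_nonneg N
  have hm0 : (0 : ℝ) ≤ charged (1 / 100) y := Nat.cast_nonneg _
  have hmN : (charged (1 / 100) y : ℝ) ≤ N := charged_le _ y
  have hpow : (0 : ℝ) ≤ (N : ℝ) ^ (2 / 3 : ℝ) := Real.rpow_nonneg hN _
  have hC : 0 ≤ max C 0 := le_max_right _ _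
  have hk1 : min κ (min g ρ₁) ≤ κ := min_le_left _ _
  have hk2 : min κ (min g ρ₁) ≤ g := (min_le_right _ _).trans (min_le_left _ _)
  have hk3 : min κ (min g ρ₁) ≤ ρ₁ := (min_le_right _ _).trans (min_le_right _ _)
  have hCp : 0 ≤ max C 0 * (N : ℝ) ^ (2 / 3 : ℝ) := mul_nonneg hC hpow
  by_cases hdense : ρ₁ * (N : ℝ) ≤ (charged (1 / 100) y : ℝ)
  · -- dense charge: the phase gap pays `g·N ≥ g·#ch`
    have hE := hP N y hy hdense
    have : min κ (min g ρ₁) * (charged (1 / 100) y : ℝ) ≤ g * N :=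
      (mul_le_mul_of_nonneg_right hk2 hm0).trans (mul_le_mul_of_nonneg_left hmN hg.le)
    nlinarith
  · push Not at hdense
    by_cases hnear : interactionEnergy lennardJones y ≤ (N : ℝ) * (eStar + ρ₁)
    · -- sparse near-minimiser: the sparse price applies
      have hE := hS N y hy hdense.le hnear
      have h1 : min κ (min g ρ₁) * (charged (1 / 100) y : ℝ) ≤ κ * (charged (1 / 100) y : ℝ) :=
        mul_le_mul_of_nonneg_right hk1 hm0
      have h2 : C * (N : ℝ) ^ (2 / 3 : ℝ) ≤ max C 0 * (N : ℝ) ^ (2 / 3 : ℝ) :=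
        mul_le_mul_of_nonneg_right (le_max_left _ _) hpow
      linarith
    · -- far from optimal: the excess `> ρ₁ N ≥ ρ₁·#ch` pays
      push Not at hnear
      have h1 : min κ (min g ρ₁) * (charged (1 / 100) y : ℝ) ≤ ρ₁ * (charged (1 / 100) y : ℝ) :=
        mul_le_mul_of_nonneg_right hk3 hm0
      have h2 : ρ₁ * (charged (1 / 100) y : ℝ) ≤ ρ₁ * N := mul_le_mul_of_nonneg_left hmN hρ₁.le
      nlinarith

/-- **`ChargedEnergyGap ↔ QualitativeChargeGap ∧ SparsePricing`**: the charge-density split of the sibling crux is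
lossless. [folklore] -/
theorem chargedEnergyGap_iff_qualitativeChargeGap_and_sparsePricing :
    ChargedEnergyGap ↔ QualitativeChargeGapWith (1 / 100) ∧ SparsePricingWith (1 / 100) :=
  ⟨fun h => ⟨qualitativeChargeGap_of_chargedEnergyGap h, sparsePricing_of_chargedEnergyGap h⟩,
    fun h => chargedEnergyGap_of_qualitativeChargeGap_of_sparsePricing h.1 h.2⟩

/-- **Stub 2 of the line is equivalent to its sparse core**: `(Sub₁ → ChargedEnergyGap) ↔ (Sub₁ → SparsePricing)`.
[folklore] -/
theorem qualitativeToPricedGap_iff_sparsePricing :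
    (QualitativeChargeGapWith (1 / 100) → ChargedEnergyGap) ↔
      (QualitativeChargeGapWith (1 / 100) → SparsePricingWith (1 / 100)) :=
  ⟨fun h h₁ => sparsePricing_of_chargedEnergyGap (h h₁),
    fun h h₁ => chargedEnergyGap_of_qualitativeChargeGap_of_sparsePricing h₁ (h h₁)⟩

/-- Stub 2 read through 14231's one-number form: `(Sub₁ → ChargedEnergyGap) ↔ (Sub₁ → 0 < κ_max(1/100))`.
[folklore] -/
theorem qualitativeToPricedGap_iff_kappaMax :
    (QualitativeChargeGapWith (1 / 100) → ChargedEnergyGap) ↔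
      (QualitativeChargeGapWith (1 / 100) → 0 < kappaMax (1 / 100)) := by
  rw [chargedEnergyGap_iff_kappaMax_pos]

/-! ## Provers of Sub₁ may work on periodic configurations only -/

/-- `e* ≤ −1/24` (the far periodisation of the dimer; unconditional). [folklore] -/
theorem eStar_le_neg : eStar ≤ -1 / 24 := by
  have h := card_mul_eStar_le (N := 2) dimer_injective
  rw [interactionEnergy_dimer] at h
  push_cast at h
  linarith

/-- **`PeriodicPhaseGapWith η → QualitativeChargeGapWith η`** (`η ≤ 1`).  For `N ≥ 2` periodise `y` far
(`periodiseFar`, period `8D + 8`): the motif is `{yᵢ}`, its charged points read in the periodic point set are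
exactly the charged sites of `y` (`motifCharged_periodiseFar`), so the charged fraction of the motif is
`#ch(y)/N ≥ ρ`, while `e(Q) ≤ E_LJ(y)/N` (`energyPerParticle_periodise_le`); `N ≤ 1` is settled by `e* ≤ −1/24`
with the gap capped at `1/24`. [folklore] -/
theorem qualitativeChargeGap_of_periodicPhaseGap {η : ℝ} (hη1 : η ≤ 1) (h : PeriodicPhaseGapWith η) :
    QualitativeChargeGapWith η := by
  rw [qualitativeChargeGapWith_iff]
  intro ρ hρ
  obtain ⟨g, hg, hQ⟩ := h ρ hρ
  refine ⟨min g (1 / 24), lt_min hg (by norm_num), fun N y hy hρN => ?_⟩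
  have hg1 : min g (1 / 24) ≤ g := min_le_left _ _
  have hg2 : min g (1 / 24) ≤ 1 / 24 := min_le_right _ _
  rcases Nat.lt_or_ge N 2 with hN2 | hN2
  · interval_cases N
    · simp [interactionEnergy]
    · rw [interactionEnergy_of_subsingleton]
      push_cast
      linarith [eStar_le_neg]
  · have hN0 : 0 < N := by omega
    have hNr : (0 : ℝ) < N := by exact_mod_cast hN0
    have hN2' : ∀ i : Fin N, ∃ j, j ≠ i := exists_ne_of_two_le hN2
    set Q := periodiseFar y hN0 with hQdef
    have hcard : ((Q.motif.card : ℕ) : ℝ) = N := by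
      rw [hQdef, motif_periodiseFar, Finset.card_image_of_injective _ hy, Finset.card_univ, Fintype.card_fin]
    have hfrac : ρ ≤ chargedFraction η Q := by
      rw [chargedFraction, hcard, le_div_iff₀ hNr, hQdef,
        motifCharged_periodiseFar hy hN0 hη1 hN2']
      exact hρN
    have he := hQ Q hfrac
    have hper := energyPerParticle_periodise_le hy (spacingUnit y) (period_le_spacing y) hN0
    rw [le_div_iff₀ hNr, mul_comm] at hper
    have hper' : (N : ℝ) * Q.energyPerParticle lennardJones ≤ interactionEnergy lennardJones y := hper
    calc (N : ℝ) * (eStar + min g (1 / 24)) ≤ (N : ℝ) * (eStar + g) := by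
          exact mul_le_mul_of_nonneg_left (by linarith) hNr.le
      _ ≤ (N : ℝ) * Q.energyPerParticle lennardJones := mul_le_mul_of_nonneg_left he hNr.le
      _ ≤ interactionEnergy lennardJones y := hper'

end Summit.AtomisticToContinuum.Crystallization.Theorems.PricedLinkCensusLocalToGlobalPhaseGap

end
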